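import Mathlib.Analysis.Complex.Basic
import Mathlib.Algebra.Polynomial.Eval.Defs
import Mathlib.GroupTheory.Index
import HarnessLib

/-!
# Shelstad (1979), §4 «Stable orbital integrals» — the numbered statements as named predicates

D. Shelstad, *Characters and inner forms of a quasi-split group over ℝ*, Compositio Math. **39** (1979) 11–45
[Shelstad1979], §4 = pp. 20–38.  PAGE PINS «(p. N)» are the printed Compositio pages.  The text was read on the NUMDAM
scan `http://www.numdam.org/article/CM_1979__39_1_11_0.pdf` (`lit read` key `paper:url-551fef475f69`, file `pNNNN.txt`
= printed p. NNNN+9); its OCR layer omits every displayed formula, so ALL displays below were read on the page IMAGES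
decoded from the same PDF (`T/LNS/TN-t03/g3/pages-Shelstad1979/pNNNN_{top,bot}.png` in the HCML cell, same numbering).
Squad TN (HCML «GO 500», DEAL v8 row TN-t03 g3); topic `NumberTheory/Automorphic/Shelstad1979`, namespace
`Literature.NumberTheory.Automorphic.Shelstad1979.StableOrbitalIntegrals`.  STATEMENTS ONLY: no theorem, no `sorry`,
no axiom, no instance, no notation.

## Standing setting (§2 pp. 12–16, §4 p. 20)
`G` is a connected reductive group over `ℝ`, `G = G(ℝ)`; `G′` is quasi-split over `ℝ` and `G` is an inner form of
`G′` through a FIXED isomorphism `ψ : G → G′` with `ψ̄ψ⁻¹` inner (p. 13).  For a Cartan subgroup `T` of `G`: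
`𝔄(T) = {g ∈ G(ℂ) : ad g|T is defined over ℝ} = {g ∈ G(ℂ) : gTg⁻¹ ⊂ G}` (p. 13), `𝒟(T) = G \ 𝔄(T) / T(ℂ)`
(p. 20; finite, p. 14), `γ^ω = ωγω⁻¹`; «`γ′ ∈ G′` originates from `γ ∈ G_reg`» iff `ψ_x(γ) = γ′` for some `x ∈ G′(ℂ)`
with `ψ_x = ad x ∘ ψ : T_γ → T_{γ′}` defined over `ℝ` (p. 16); `Ω(G,T)` is the (complex) Weyl group and `Ω_ℝ(G,T)`
(print: lightface `Ω(G, T)`) its subgroup of elements realized in `G` (p. 12); `M` is the centralizer of the maximal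
`ℝ`-split torus `S(T)` of `T`, so `Ω(M,T)` is the imaginary Weyl group (p. 13); imaginary roots are compact or noncompact
(p. 15); a Cayley transform `s` with respect to a noncompact imaginary root `α` is an `s ∈ G(ℂ)` with `s̄⁻¹s` realizing
the reflection `ω_α` (p. 15), `T_s = sTs⁻¹`.  `2q_G` is the dimension of the symmetric space of the simply connected
cover of the derived group of `G`, and `q_{G′} − q_G ∈ ℤ` (pp. 19–20).  Orbital integrals (p. 20): for `γ` regular,
`Φ_f(γ, dt, dg) = ∫_{G/T_γ} f(gγg⁻¹) dḡ` (absolutely convergent for Schwartz `f`), with `d_γt = d_{γ′}t` on a common Cartan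
subgroup and `(dt)^ω` the transported measure on `T^ω`; on `G` the measures `dg, dt` are those deduced from `dg′, dt′` on
`G′, T′` through `ψ` and `ψ_x` (p. 20).  These §2 notions are NOT declared here (they are the business of the §§2–3 file
`…/Shelstad1979/InnerFormsAndCharacters.lean`, squad seat TN-t09); every numbered item below takes them as EXPLICIT DATA,
the tree's discipline for printed statements about objects Lean cannot yet construct (cf. the sibling carpets
`Literature.NumberTheory.Automorphic.LanglandsShelstad1987.Properties`, `…Rogawski1990.IsInnerTransferRel`: «all data are
PARAMETERS; instantiated with print's objects the predicate is exactly the printed statement; `∀ data, …` is NOT claimed»).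
Where print DEFINES an object from such data the definition is REAL (a `def` with a body): `shelstadStableSum` (`Φ¹_f`,
p. 20), `innerFormSign` (`(−1)^{q_G − q_{G′}}`, p. 21), `weylFactorR` (`R_T`, p. 22), `normalisedFn` (`Ψ^T = R_T Φ^T`,
p. 22; `Ψ^ω_f`, p. 23), `imaginaryRegularSet` (`T^I_reg`, p. 22), `IsSemiregularFor` (p. 22), `HasOneSidedJump` (the
«`lim_{ν↓0} − lim_{ν↑0}`» of pp. 22–31), `cayleyMultiplicity` (`d(α)`, p. 26), `hcSeminorm` (`ν_{(X,Y,m)}`, p. 35).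

## The data, in print's words (binders used below)
* `S : Set (G → ℂ)`, `S' : Set (G' → ℂ)` — the Schwartz spaces `𝒞(G)`, `𝒞(G′)` [6 = Harish-Chandra] (p. 20, p. 35);
  `reg' : Set G'` — `G′_reg`; `orig : G' → G → Prop` — «`γ′` originates from `γ`» (p. 16).
* `Φ1 : (G → ℂ) → G → ℂ` — `(f, γ) ↦ Φ¹_f(γ, dt, dg)` at the measures fixed on p. 20 (`shelstadStableSum` below is print's
  formula for it from the ordinary orbital integrals); `Φ1' : (G' → ℂ) → G' → ℂ` — the same on `G′` at `dt′, dg′`.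
* `D : G → Type*` (finite) with `conj : (γ : G) → D γ → G` — `𝒟(T_γ)` and `ω ↦ γ^ω` on chosen representatives;
  `A : G → Type*` with `act` — `𝔄(T_γ)` acting by `γ ↦ γ^ω`.
* Roots and Weyl groups (Lemma 4.2, Props 4.6, 4.11): `Rt` — the roots of `T(ℂ)` in `G(ℂ)`, `neg : Rt → Rt` — `α ↦ −α`,
  `Ω` a group acting on `Rt` — `Ω(G,T)`, `ΩM ≤ Ω` — `Ω(M,T)`, `ΩMr ≤ Ω` — `Ω_ℝ(M,T)` (realized in `G`, equivalently in `M`),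
  `imaginary noncompact : Rt → Prop`, `hasCayley α` — «there exists `s ∈ G(ℂ)` such that `s̄⁻¹s` realizes `ω_α`» (p. 37).
* The jump data at a semiregular `γ₀` (pp. 22–25): `T`, `Ts` — the Cartan subgroups `T` and `T_s`; `𝒯`, `𝒯s` — the
  algebras of invariant differential operators on `T`, `T_s`, with their actions `applyT`, `applyS` on functions;
  `hatT : 𝒯 → 𝒯` — `D ↦ D̂`, induced by `H ↦ H + ι(H)I`, `ι = ½ Σ_{α ∈ I⁺} α` (p. 24); `toS : 𝒯 → 𝒯s` — `D ↦ D^s`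
  (p. 24); `hatS : 𝒯s → 𝒯s` — `D′ ↦ D̂′` via `ι_s` (p. 24), so print's `\widehat{D^s}` is `hatS (toS D)`;
  `curve : ℝ → T` — `ν ↦ γ_ν = γ₀ exp(iνH_α)` (p. 22); `γ0s : Ts` — `γ₀^s` (p. 25; `= γ₀` for a standard `s`, p. 26);
  `ΨT : T → ℂ`, `ΨTs : Ts → ℂ` — `Ψ^T(·, dt, dg)` and `Ψ^{T_s}(·, (dt)^s, dg)` with `(dt)^s` as on p. 24.
* Families (Thm 4.7, Lemma 4.8, Prop 4.9): `C` — the set `𝔱(G)` of conjugacy classes `⟨T⟩` of Cartan subgroups with the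
  partial order `⟨T₁⟩ ≤ ⟨T₂⟩ ⇔ S(T₁) ⊂ S(T₂)` up to conjugacy (p. 13); `V : C → Type*` with `0` — for a class `c`, the
  functions `{γ ↦ Φ^T(γ, dt, dg)}` on the various `T_reg`, `T ∈ c`, all `dt`, `dg` (p. 21, p. 32); `famOf : (G → ℂ) → (c : C)
  → V c` — `f ↦ {Φ¹_f(·, dt, dg)}_{T ∈ c}`; `condI … condIIIb`, `condIII'` — conditions (I)–(IIIb), (III′) as predicates on
  `V c` (they are spelled out, one `T` and one `γ₀` at a time, by the predicates `Shelstad1979_4_7_I_…` … `…_IIIb_…`).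

## Item ↦ declaration (paper order)
| print | page | declaration |
|---|---|---|
| §4 definition `Φ¹_f(γ, dt, dg) = Σ_{ω ∈ 𝒟(T)} Φ_f(γ^ω, (dt)^ω, dg)` | p. 20 | `shelstadStableSum` |
| §4 «Clearly `Φ¹_f(γ^ω, (dt)^ω, dg) = Φ¹_f(γ, dt, dg)` for each `ω ∈ 𝔄(T)`» = Thm 4.7 (II) | pp. 20, 31 | `Shelstad1979_4_7_II_stableInvariance` |
| §4 «the map `γ′ ↦ Φ¹_f(γ)` (γ′ originates from γ), `0` (else) on `G′_reg` is well-defined» | p. 21 | `Shelstad1979_4_transferWellDefined` |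
| the constant `(−1)^{q_G − q_{G′}}` | p. 21 | `innerFormSign` |
| **Theorem 4.1** (transfer of stable orbital integrals to the quasi-split inner form) | p. 21 | `Shelstad1979_4_1_transfer` |
| §4 «`Φ¹_f(γ, αdt, βdg) = (β/α) Φ¹_f(γ, dt, dg)`» = Thm 4.7 (I) | pp. 21, 30 | `Shelstad1979_4_7_I_homogeneity` |
| `R_T(γ)`, `Ψ^T_f = R_T Φ¹_f`, `T^I_reg`, semiregular `γ₀`, `γ_ν` | p. 22 | `weylFactorR`, `normalisedFn`, `imaginaryRegularSet`, `IsSemiregularFor` |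
| **Lemma 4.2** | p. 23 | `Shelstad1979_4_2_noncompactUpToSign` |
| **Lemma 4.3** (the jump formula for `Ψ^T_f`) | p. 25 | `Shelstad1979_4_3_jump` |
| **Proposition 4.4** | p. 25 | `Shelstad1979_4_4_indices` |
| **Proposition 4.5** (jump of `D̂Ψ^δ_f`), `d(α)` | p. 26 | `Shelstad1979_4_5_jumpDelta`, `cayleyMultiplicity` |
| orbits of `⟨1, ω_α⟩` on the `α`-fixing classes of `𝒟(T)` («one element ∕ two elements») | p. 29 | `Shelstad1979_4_6_orbitSizes` |
| **Proposition 4.6** (`𝒟(T_s) → 𝒟_α(T)` bijective) | p. 29 | `Shelstad1979_4_6_bijection` |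
| **Theorem 4.7** (characterization of families of stable orbital integrals) + (I), (II), (IIIa), (IIIb) | pp. 30–31 | `Shelstad1979_4_7_characterization`, `…_I_homogeneity`, `…_II_stableInvariance`, `…_IIIa_continuity`, `…_IIIb_jump` |
| **Lemma 4.8** | pp. 32–33 | `Shelstad1979_4_8_existence` |
| `ν_{(X,Y,m)}(f)`, **Proposition 4.9** | p. 35 | `hcSeminorm`, `Shelstad1979_4_9_wavePackets` |
| **Proposition 4.10** | p. 36 | `Shelstad1979_4_10_KTypeBound` |
| **Proposition 4.11** | p. 37 | `Shelstad1979_4_11_existsNoncompact` |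

DEDUP (`lean search`, `rg 'cite: Shelstad1979'`): no `Literature/…/Shelstad1979/` file exists; the 99 tree tags
`[cite: Shelstad1979, §4 ∕ Thm. 4.1 ∕ Thm. 4.7]` are PROVENANCE tags on explicit `U(3)`-model statements under
`Literature/NumberTheory/Rogawski1990/Arch*` and `…/Automorphic/Arch*` and on the H413 crux lines — specialisations and
consumers, not the abstract statements, which are new.  See also (not imported, different constructions of the same
notion): ★ `Literature.NumberTheory.Rogawski1990.stableOrbitalIntegralRel` (a `finsum` over the conjugacy classes inside a
stable class, [Rogawski1990, (4.1.1)]) and ★ `…Rogawski1990.IsInnerTransferRel corr stB stA regA m′ m f′ f` ([Rogawski1990,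
(14.2.1)]): Theorem 4.1 below is the archimedean SOURCE of that relation, with print's roles (`G` inner form carrying `f`,
`G′` quasi-split receiving `f′`) = Rogawski's (`G′_v`, `G_v`) and print's sign `(−1)^{q_G − q_{G′}}` explicit (it is `+1`
for `(U(3), U(2,1))`: `q = 0, 2`).  Mathlib has no real-reductive-group vocabulary (Cartan subgroups, Schwartz space
`𝒞(G)`, invariant differential operators on a Lie group, `K`-types); hence the parameters.

READING NOTES (for the D-CITE ∕ referee desks).  (i) Print's (IIIa) (p. 31) displays «`lim_{ν↑0} DΨ^T(γ_ν) = lim_{ν↑0}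
DΨ^T(γ_ν)`» with `ν↑0` on both sides and p. 22 l. −4 has `ν↓0` twice; the intended statement (pp. 22–23: «if … these
limits are equal then `Ψ^T_f` extends», and (2)) is equality of the two ONE-SIDED limits, typed as a zero jump.  (ii) In
(IIIb) p. 31 the first `D` carries no hat while Lemma 4.3 (p. 25) and p. 32 («(IIIb) becomes `lim_{ν↓0} D̂Ψ^T(γ_ν) =
i\widehat{D^s}Ψ^{T_s}(γ₀^s)`») have `D̂` on both limits; typed with `D̂` on both, as in Lemma 4.3.

NOT typed here: the proofs; the intermediate displays (1) p. 22 (`Ψ^T_f` via Harish-Chandra's `'F_f`), (2) p. 23 (the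
jump of `DΨ^T_f` at `γ₀` is the sum of the jumps of the `DΨ^ω_f`, `ωα` noncompact — a consequence of `Ψ^T_f = Σ_ω Ψ^ω_f`,
finite additivity of one-sided limits, and the existence ∕ vanishing of the individual jumps from [6], p. 22; nothing to
state beyond [6]), p. 23 (`Ψ^T_f(γ^ω) = (det ω) ξ_{ι−ω⁻¹ι}(γ) Ψ^T_f(γ)`), pp. 26–29 ((A), (B) in the proof of Prop. 4.5), pp. 33–35 (the Fourier
analysis on `𝔛 × 𝔞*` and the function `y(Λ, ν)`, which enters Prop. 4.9 (1) as the datum `packetValue`); §§2–3 and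
§§5–6 (sibling files `InnerFormsAndCharacters`, `Correspondences`).

## References
* [Shelstad1979] D. Shelstad, *Characters and inner forms of a quasi-split group over ℝ*, Compositio Math. 39 (1979)
  11–45: §4 pp. 20–38 (Thm 4.1 p. 21, Lemma 4.2 p. 23, Lemma 4.3 p. 25, Prop 4.4 p. 25, Prop 4.5 p. 26, Prop 4.6 p. 29,
  Thm 4.7 pp. 30–31, Lemma 4.8 pp. 32–33, Prop 4.9 p. 35, Prop 4.10 p. 36, Prop 4.11 p. 37), with §2 pp. 12–16 and the
  end of §3 pp. 19–20 for the standing notions; NUMDAM `CM_1979__39_1_11_0`.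
* [6] = Harish-Chandra, *Harmonic analysis on real reductive groups I*, J. Funct. Anal. 19 (1975) 104–204 (the Schwartz
  space, `'F_f`, the jump relations) — cited by print throughout §4; not used here beyond the names.
* [Rogawski1990] J. Rogawski, *Automorphic representations of unitary groups in three variables*, §4.1, §14.2 — the
  tree's consumer-side currency (see DEDUP).
-/

open Filter Topology
open scoped BigOperators

namespace Literature.NumberTheory.Automorphic.Shelstad1979.StableOrbitalIntegrals

/-! ## §4, pp. 20–21: stable orbital integrals, their two elementary properties, and Theorem 4.1 -/

section StableSum

variable {G : Type*}

/-- **Shelstad's stable orbital integral** `Φ¹_f(γ, dt, dg) = Σ_{ω ∈ 𝒟(T)} Φ_f(γ^ω, (dt)^ω, dg)` (`T = T_γ`), a finite sum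
over `𝒟(T) = G \ 𝔄(T) / T(ℂ)` of ordinary orbital integrals at the stable conjugates `γ^ω` («It is easily seen that
`Φ_f(γ^ω, (dt)^ω, dg)` depends only on the class of `ω` in `𝒟(T)`»).  Data: `D γ` — the finite set `𝒟(T_γ)` (finite by
p. 14); `conj γ ω` — `γ^ω` for a chosen representative; `Φ f δ` — `Φ_f(δ, d_δt, dg)` with the measure conventions of p. 20
folded in (so `Φ f (conj γ ω) = Φ_f(γ^ω, (dt)^ω, dg)`).  See also ★ `Rogawski1990.stableOrbitalIntegralRel` (a different
bookkeeping of the same sum). [cite: Shelstad1979, §4 (p. 20)] -/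
def shelstadStableSum {D : G → Type*} [∀ γ, Fintype (D γ)] (Φ : (G → ℂ) → G → ℂ) (conj : (γ : G) → D γ → G)
    (f : G → ℂ) (γ : G) : ℂ :=
  ∑ ω : D γ, Φ f (conj γ ω)

/-- **(II) — invariance under stable conjugation**: «Clearly `Φ¹_f(γ^ω, (dt)^ω, dg) = Φ¹_f(γ, dt, dg)` for each
`ω ∈ 𝔄(T)`» (p. 20, repeated p. 21), which is condition (II) of Theorem 4.7, «`Φ^T(γ, dt, dg) = Φ^{T^ω}(γ^ω, (dt)^ω, dg)` for
`ω ∈ 𝔄(T)`» (p. 31), for the family `Φ^T = Φ¹_f`.  Data: `act γ ω` — `γ^ω` for `ω ∈ 𝔄(T_γ)` (`A γ`); `Φ1 : G → ℂ` — the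
function `γ ↦ Φ^{T_γ}(γ, dt, dg)` with the transported measures folded in.
[cite: Shelstad1979, §4 (p. 20); Thm. 4.7 (II) (p. 31)] -/
def Shelstad1979_4_7_II_stableInvariance {A : G → Type*} (act : (γ : G) → A γ → G) (Φ1 : G → ℂ) : Prop :=
  ∀ (γ : G) (ω : A γ), Φ1 (act γ ω) = Φ1 γ

/-- «Recalling the observations of Section 2, we see that our definition of `Φ¹_f` ensures that the map
`γ′ ↦ Φ¹_f(γ, dt, dg)` if `γ′` originates from `γ` in `G`, `↦ 0` if `γ′` does not originate in `G`, on `G′_reg` is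
well-defined» — i.e. the value does not depend on the element `γ` from which `γ′` originates (by p. 16 these are exactly the
`γ^w`, `w ∈ 𝔄(T_γ)`).  Data: `orig γ′ γ` — «`γ′` originates from `γ`»; `Φ1f : G → ℂ` — `γ ↦ Φ¹_f(γ, dt, dg)`.
[cite: Shelstad1979, §4 (p. 21)] -/
def Shelstad1979_4_transferWellDefined {G' : Type*} (reg' : Set G') (orig : G' → G → Prop) (Φ1f : G → ℂ) : Prop :=
  ∀ γ' ∈ reg', ∀ γ₁ γ₂ : G, orig γ' γ₁ → orig γ' γ₂ → Φ1f γ₁ = Φ1f γ₂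

/-- The constant `(−1)^{q_G − q_{G′}}` of Theorem 4.1 («inserted to obtain the identity of Corollary 6.7»), as a function of
the INTEGER `q = q_G − q_{G′}` («Note that `q_{G′} − q_G` is an integer», p. 20; `2q_G` = dimension of the symmetric space
attached to the simply connected covering of the derived group of `G`, p. 19). [cite: Shelstad1979, §4 (pp. 19–21)] -/
noncomputable def innerFormSign (q : ℤ) : ℂ :=
  (-1 : ℂ) ^ q

/-- **Theorem 4.1 (transfer of stable orbital integrals from `G` to its quasi-split inner form `G′`).**  «Let `f` be a
Schwartz function on `G`.  Then there is a Schwartz function `f′` on `G′` such that, for `γ′ ∈ G′_reg`,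
`Φ¹_{f′}(γ′, dt′, dg′) = (−1)^{q_G − q_{G′}} Φ¹_f(γ, dt, dg)` if `γ′` originates from `γ` in `G`, and
`Φ¹_{f′}(γ′, dt′, dg′) = 0` if `γ′` does not originate in `G`.»  Data (module doc): `S`, `S'` the Schwartz spaces of `G`,
`G′`; `reg'` = `G′_reg`; `orig`; `Φ1 f γ = Φ¹_f(γ, dt, dg)` and `Φ1' f′ γ′ = Φ¹_{f′}(γ′, dt′, dg′)` at measures matched through
`ψ` as on p. 20 (`dg′`, `dt′` arbitrary); `q = q_G − q_{G′}`.  For the tree's `U(3)` consumers (★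
`Rogawski1990.IsArchInnerTransferExists`, organ «f ↦ f^H on the Schwartz space» of the H413 lines): print's `(G, G′)` is
their `(G′_∞, G_∞)` and `innerFormSign q = 1` there. [cite: Shelstad1979, Thm. 4.1 (p. 21)] -/
def Shelstad1979_4_1_transfer {G' : Type*} (S : Set (G → ℂ)) (S' : Set (G' → ℂ)) (reg' : Set G')
    (orig : G' → G → Prop) (Φ1 : (G → ℂ) → G → ℂ) (Φ1' : (G' → ℂ) → G' → ℂ) (q : ℤ) : Prop :=
  ∀ f ∈ S, ∃ f' ∈ S', ∀ γ' ∈ reg',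
    (∀ γ : G, orig γ' γ → Φ1' f' γ' = innerFormSign q * Φ1 f γ) ∧
      ((∀ γ : G, ¬ orig γ' γ) → Φ1' f' γ' = 0)

/-- **(I) — homogeneity in the measures**: «It is immediate that `Φ¹_f(γ, αdt, βdg) = (β/α) Φ¹_f(γ, dt, dg)` for
`α, β > 0`» (p. 21), which is condition (I) of Theorem 4.7 for a family `Φ^T` (p. 30).  Data: `ΦT a b γ` — the value
`Φ^T(γ, a·dt₀, b·dg₀)` relative to fixed reference Haar measures `dt₀`, `dg₀` (every Haar measure is a positive multiple).
[cite: Shelstad1979, §4 (p. 21); Thm. 4.7 (I) (p. 30)] -/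
def Shelstad1979_4_7_I_homogeneity {Tr : Type*} (ΦT : ℝ → ℝ → Tr → ℂ) : Prop :=
  ∀ a b α β : ℝ, 0 < a → 0 < b → 0 < α → 0 < β →
    ∀ γ : Tr, ΦT (α * a) (β * b) γ = ((β / α : ℝ) : ℂ) * ΦT a b γ

end StableSum

/-! ## §4, pp. 22–23: the normalised functions `Ψ^T_f`, semiregular elements, one-sided limits -/

section Normalised

variable {T : Type*}

/-- `R_T(γ) = |det(Ad γ − 1)_{𝔤/𝔪}|^{1/2} Π_{α ∈ I⁺} (1 − ξ_α(γ⁻¹))` for `γ ∈ T`, `I⁺` a system of positive imaginary roots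
(roots of `T` in `M`), `ξ_α` the quasi-character of `T` attached to `α`.  Data: `absDet γ` — `|det(Ad γ − 1)_{𝔤/𝔪}|^{1/2}`;
`ξ : I → T → ℂ` — `α ↦ ξ_α` on the finite index type `I` of `I⁺`. [cite: Shelstad1979, §4 (p. 22)] -/
def weylFactorR [Group T] {I : Type*} [Fintype I] (absDet : T → ℝ) (ξ : I → T → ℂ) (γ : T) : ℂ :=
  (absDet γ : ℂ) * ∏ α : I, (1 - ξ α γ⁻¹)

/-- `Ψ^T_f(γ) = R_T(γ) Φ¹_f(γ, dt, dg)` for `γ ∈ T_reg` (p. 22); with `Φ = γ ↦ Φ_f(γ^ω)` it is `Ψ^ω_f(γ) = R_T(γ) Φ_f(γ^ω)`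
(p. 23), and with an abstract family `Φ^T` it is the `Ψ^T` of Theorem 4.7 (III).  Data: `R` — `R_T`; `Φ` — the function
being normalised. [cite: Shelstad1979, §4 (pp. 22–23)] -/
def normalisedFn (R : T → ℂ) (Φ : T → ℂ) : T → ℂ :=
  fun γ => R γ * Φ γ

/-- `T^I_reg = {γ ∈ T : ξ_α(γ) ≠ 1, α ∈ I⁺}`, the dense open subset of `T` on which `Ψ^T_f` is a Schwartz function
(p. 22).  Data: `ξ : I → T → ℂ` as in `weylFactorR`. [cite: Shelstad1979, §4 (p. 22)] -/
def imaginaryRegularSet {I : Type*} (ξ : I → T → ℂ) : Set T :=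
  {γ | ∀ α : I, ξ α γ ≠ 1}

/-- «`γ₀` is a semiregular element in `T − T^I_reg`.  Then there are exactly two imaginary roots `β`, say `±α`, for which
`ξ_β(γ₀) = 1`» (p. 22): the predicate «`γ₀` is semiregular, with `±α` the roots trivial on it».  Data: `Rt` — ALL the roots
of `T(ℂ)` in `G(ℂ)` (so that «exactly `±α` are trivial on `γ₀`» IS semiregularity; print assumes `γ₀ ∈ T − T^I_reg`
semiregular and derives that the two roots are the imaginary `±α`), `neg` — `β ↦ −β`, `ξ β` — `ξ_β` (the quasi-character
`γ ↦ β(γ)`). [cite: Shelstad1979, §4 (p. 22)] -/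
def IsSemiregularFor {Rt : Type*} (ξ : Rt → T → ℂ) (neg : Rt → Rt) (γ₀ : T) (α : Rt) : Prop :=
  ξ α γ₀ = 1 ∧ ξ (neg α) γ₀ = 1 ∧ ∀ β : Rt, ξ β γ₀ = 1 → β = α ∨ β = neg α

/-- «`lim_{ν↓0} F(γ_ν)` and `lim_{ν↑0} F(γ_ν)` are well-defined» and their DIFFERENCE is `J` — the shape of every jump
statement of pp. 22–32 ((2), Lemma 4.3, Prop. 4.5, (IIIa), (IIIb)), for a function `F : ℝ → ℂ` of the parameter `ν` of
`γ_ν = γ₀ exp(iνH_α)`: both one-sided limits at `ν = 0` exist and `lim_{ν↓0} F − lim_{ν↑0} F = J`.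
[cite: Shelstad1979, §4 (pp. 22–23)] -/
def HasOneSidedJump (F : ℝ → ℂ) (J : ℂ) : Prop :=
  ∃ Lp Lm : ℂ, Tendsto F (𝓝[>] (0 : ℝ)) (𝓝 Lp) ∧ Tendsto F (𝓝[<] (0 : ℝ)) (𝓝 Lm) ∧ Lp - Lm = J

end Normalised

/-! ## §4, p. 23 and p. 37: the two root-theoretic statements (Lemma 4.2, Proposition 4.11) -/

section Roots

variable {Rt Ω : Type*} [Group Ω] [MulAction Ω Rt]

/-- **Lemma 4.2.**  «Suppose that `α` is noncompact.  Then if `ωα` is also noncompact, `ω ∈ Ω(M, T)` [the imaginary Weyl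
group], there exists `ω₀ ∈ Ω_ℝ(M, T)` [print: lightface `Ω(M, T)`, the elements realized in `G`] such that `ωα = ±ω₀α`.»
Data (module doc): `ΩM` — `Ω(M,T)`; `ΩMr` — `Ω_ℝ(M,T)`; `noncompact`; `neg` — `β ↦ −β`; `α` an imaginary root.
[cite: Shelstad1979, Lemma 4.2 (p. 23)] -/
def Shelstad1979_4_2_noncompactUpToSign (ΩM ΩMr : Subgroup Ω) (noncompact : Rt → Prop) (neg : Rt → Rt)
    (α : Rt) : Prop :=
  noncompact α → ∀ ω ∈ ΩM, noncompact (ω • α) →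
    ∃ ω₀ ∈ ΩMr, ω • α = ω₀ • α ∨ ω • α = neg (ω₀ • α)

/-- **Proposition 4.11.**  «Suppose that `α` is an imaginary root of `T` in `G` and that there exists `s ∈ G(ℂ)` such that
`s̄⁻¹s` realizes `ω_α`.  Then there exists `ω ∈ Ω(M, T)` such that `ωα` is noncompact.»  («Recall that `M` is the
centralizer in `G` of the `ℝ`-split part of `T`.»)  Data: `ΩM` — `Ω(M,T)`; `imaginary`, `noncompact`; `hasCayley α` —
the displayed hypothesis on `α`. [cite: Shelstad1979, Prop. 4.11 (p. 37)] -/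
def Shelstad1979_4_11_existsNoncompact (ΩM : Subgroup Ω) (imaginary noncompact hasCayley : Rt → Prop)
    (α : Rt) : Prop :=
  imaginary α → hasCayley α → ∃ ω ∈ ΩM, noncompact (ω • α)

end Roots

/-! ## §4, pp. 24–31: the jump formulas (Lemma 4.3, Proposition 4.5, conditions (IIIa), (IIIb)) -/

section Jumps

variable {T Ts 𝒯 𝒯s : Type*}

/-- **Condition (IIIb) of Theorem 4.7** at a semiregular `γ₀ ∈ T − T^I_reg` with `ξ_α(γ₀) = 1`, `α` NONCOMPACT, `I⁺`
adapted to `α` (p. 31, in the form of Lemma 4.3 and p. 32 — READING NOTE (ii)): for each `D ∈ 𝒯`,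
`lim_{ν↓0} D̂Ψ^T(γ_ν, dt, dg) − lim_{ν↑0} D̂Ψ^T(γ_ν, dt, dg) = 2i · \widehat{D^s}Ψ^{T_s}(γ₀^s, (dt)^s, dg)`.  Data (module
doc, «jump data»): `applyT`, `applyS`, `hatT`, `hatS`, `toS`, `curve`, `γ0s`, and the two functions `ΨT = Ψ^T(·, dt, dg)`,
`ΨTs = Ψ^{T_s}(·, (dt)^s, dg)`. [cite: Shelstad1979, Thm. 4.7 (IIIb) (p. 31)] -/
def Shelstad1979_4_7_IIIb_jump (applyT : 𝒯 → (T → ℂ) → T → ℂ) (applyS : 𝒯s → (Ts → ℂ) → Ts → ℂ)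
    (hatT : 𝒯 → 𝒯) (hatS : 𝒯s → 𝒯s) (toS : 𝒯 → 𝒯s) (curve : ℝ → T) (γ0s : Ts) (ΨT : T → ℂ) (ΨTs : Ts → ℂ) :
    Prop :=
  ∀ D : 𝒯, HasOneSidedJump (fun ν => applyT (hatT D) ΨT (curve ν))
    (2 * Complex.I * applyS (hatS (toS D)) ΨTs γ0s)

/-- **Condition (IIIa) of Theorem 4.7** at a semiregular `γ₀ ∈ T − T^I_reg` with `ξ_α(γ₀) = 1` where `ωα` is COMPACT for
each `ω ∈ Ω(M,T)` (p. 31; READING NOTE (i)): for each `D ∈ 𝒯`, `lim_{ν↓0} DΨ^T(γ_ν, dt, dg) = lim_{ν↑0} DΨ^T(γ_ν, dt, dg)`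
(both limits exist and agree — typed as a zero jump).  Data: `applyT`, `curve`, `ΨT` as above.
[cite: Shelstad1979, Thm. 4.7 (IIIa) (p. 31)] -/
def Shelstad1979_4_7_IIIa_continuity (applyT : 𝒯 → (T → ℂ) → T → ℂ) (curve : ℝ → T) (ΨT : T → ℂ) : Prop :=
  ∀ D : 𝒯, HasOneSidedJump (fun ν => applyT D ΨT (curve ν)) 0

/-- **Lemma 4.3 (the jump of `Ψ^T_f` across a noncompact wall).**  For `α` noncompact, `γ₀` semiregular with `ξ_α(γ₀) = 1`,
`I⁺` adapted to `α`, `s` a Cayley transform with respect to `α`, and EVERY Schwartz function `f`: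
«`lim_{ν↓0} D̂Ψ^T_f(γ_ν, dt, dg) − lim_{ν↑0} D̂Ψ^T_f(γ_ν, dt, dg) = 2i \widehat{D^s} Ψ^{T_s}_f(γ₀^s, (dt)^s, dg)`» — i.e. the
family `{Ψ^T_f}` satisfies (IIIb).  Data: the jump data, `S` the Schwartz space, and `Ψof f`, `Ψsof f` — the functions
`Ψ^T_f(·, dt, dg)` on `T` and `Ψ^{T_s}_f(·, (dt)^s, dg)` on `T_s`. [cite: Shelstad1979, Lemma 4.3 (p. 25)] -/
def Shelstad1979_4_3_jump {G : Type*} (S : Set (G → ℂ)) (applyT : 𝒯 → (T → ℂ) → T → ℂ)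
    (applyS : 𝒯s → (Ts → ℂ) → Ts → ℂ) (hatT : 𝒯 → 𝒯) (hatS : 𝒯s → 𝒯s) (toS : 𝒯 → 𝒯s) (curve : ℝ → T)
    (γ0s : Ts) (Ψof : (G → ℂ) → T → ℂ) (Ψsof : (G → ℂ) → Ts → ℂ) : Prop :=
  ∀ f ∈ S, Shelstad1979_4_7_IIIb_jump applyT applyS hatT hatS toS curve γ0s (Ψof f) (Ψsof f)

/-- `d(α) = 2` if `ω_α` can be realized in `G` and `d(α) = 1` otherwise (Proposition 4.5).  Data: the proposition
`realized` («`ω_α` can be realized in `G`»). [cite: Shelstad1979, Prop. 4.5 (p. 26)] -/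
def cayleyMultiplicity (realized : Prop) [Decidable realized] : ℕ :=
  if realized then 2 else 1

/-- **Proposition 4.5 (jump of a single term).**  With `δ ∈ Norm(M, T)` fixed so that `δα = α` (p. 25), `s` a standard
Cayley transform, `Ψ^δ_f(γ) = R_T(γ)Φ_f(γ^δ)` and `Ψ^{sδs⁻¹}_f` the corresponding function on `T_s` (p. 23):
«`lim_{ν↓0} D̂Ψ^δ_f(γ_ν : dt : dg) − lim_{ν↑0} D̂Ψ^δ_f(γ_ν : dt : dg) = i d(α) \widehat{D^s} Ψ^{sδs⁻¹}_f(γ₀ : (dt)^s : dg)`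
where `d(α) = 2` if `ω_α` can be realized in `G` and `d(α) = 1` otherwise.»  Data: the jump data with `γ0 : Ts` — the
point `γ₀ ∈ T_s` (for standard `s`, `γ₀^s = γ₀`, p. 25); `Ψδ`, `Ψsδs` — the two displayed functions; `realized`.
[cite: Shelstad1979, Prop. 4.5 (p. 26)] -/
def Shelstad1979_4_5_jumpDelta (applyT : 𝒯 → (T → ℂ) → T → ℂ) (applyS : 𝒯s → (Ts → ℂ) → Ts → ℂ)
    (hatT : 𝒯 → 𝒯) (hatS : 𝒯s → 𝒯s) (toS : 𝒯 → 𝒯s) (curve : ℝ → T) (γ0 : Ts) (Ψδ : T → ℂ) (Ψsδs : Ts → ℂ)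
    (realized : Prop) [Decidable realized] : Prop :=
  ∀ D : 𝒯, HasOneSidedJump (fun ν => applyT (hatT D) Ψδ (curve ν))
    (Complex.I * (cayleyMultiplicity realized : ℂ) * applyS (hatS (toS D)) Ψsδs γ0)

end Jumps

/-! ## §4, p. 25 and p. 29: the structure of `G_{γ₀}` (Proposition 4.4) and the classes `𝒟_α(T)` (Proposition 4.6) -/

section Structure

/-- **Proposition 4.4.**  With `G_{γ₀}` the identity component of the centralizer of the semiregular `γ₀`, `Z` its centre,
`G⁺_{γ₀}` the (Euclidean) identity component of `G¹_{γ₀} = (G_{γ₀})_der` — the image of `SL₂(ℝ)` under the homomorphism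
defining the standard Cayley transform —, `B⁺ = T ∩ G⁺_{γ₀}`, `A⁺ = T_s ∩ G⁺_{γ₀}` (p. 25):
«(1) If `ω_α` can be realized in `G` then `[G_{γ₀} : ZG⁺_{γ₀}] = [T_s : ZA⁺] = 2`; (2) If `ω_α` cannot be realized in `G`
then `G_{γ₀} = ZG⁺_{γ₀}` and `T_s = ZA⁺`.»  Data: all five groups as subgroups `Gγ, Z, Gplus, Ts, Aplus` of the ambient
`G` (`Z` central in `G_{γ₀}`, so `ZG⁺ = Z ⊔ G⁺` and `ZA⁺ = Z ⊔ A⁺`); `realized`.  Indices are Mathlib's `Subgroup.relIndex`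
(`H.relIndex K = [K : H ∩ K]`). [cite: Shelstad1979, Prop. 4.4 (p. 25)] -/
def Shelstad1979_4_4_indices {Γ : Type*} [Group Γ] (Gγ Z Gplus Ts Aplus : Subgroup Γ) (realized : Prop) : Prop :=
  (realized → (Z ⊔ Gplus).relIndex Gγ = 2 ∧ (Z ⊔ Aplus).relIndex Ts = 2) ∧
    (¬ realized → Z ⊔ Gplus = Gγ ∧ Z ⊔ Aplus = Ts)

variable {DT DTs : Type*}

/-- «Consider [the] set of all classes in `𝒟(T)` which contain a representative `δ` in `Norm(M, T)` for which `δα = ±α`.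
There is a well-defined action of the group `⟨1, ω_α⟩` on this set, given by `GδT ↦ Gω_αδT`.  Let `𝒟_α(T)` be the set of
orbits.  If `ω_α` is realized in `G` then each orbit has just one element and if `ω_α` is not realized in `G` each orbit
has two elements.»  Data: `fix : Set DT` — that subset of `DT = 𝒟(T)`; `act : DT → DT` — the action of `ω_α` (its values
off `fix` are irrelevant); `realized`. [cite: Shelstad1979, §4 (p. 29)] -/
def Shelstad1979_4_6_orbitSizes (fix : Set DT) (act : DT → DT) (realized : Prop) : Prop :=
  (realized → ∀ c ∈ fix, act c = c) ∧ (¬ realized → ∀ c ∈ fix, act c ≠ c)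

/-- **Proposition 4.6.**  «Since `s` embeds `S(T)` in `S(T_s)` it follows that `ω ↦ s⁻¹ωs` maps `Norm(M_s, T_s)` to
`Norm(M, T)`.  PROPOSITION 4.6: The map `ω ↦ s⁻¹ωs` induces a bijection `𝒟(T_s) → 𝒟_α(T)`.»  Data: `DTs = 𝒟(T_s)`;
`fix`, `act` as in `Shelstad1979_4_6_orbitSizes`; `conjS : DTs → DT` — a class-level choice of `ω ↦ s⁻¹ωs` (print shows the
class of `s⁻¹ωs` is determined up to the `⟨1, ω_α⟩`-action; the three clauses below do not depend on the choice): it lands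
in the `α`-fixing classes, meets every `⟨1, ω_α⟩`-orbit, and two classes with the same orbit image are equal.
[cite: Shelstad1979, Prop. 4.6 (p. 29)] -/
def Shelstad1979_4_6_bijection (fix : Set DT) (act : DT → DT) (conjS : DTs → DT) : Prop :=
  (∀ x : DTs, conjS x ∈ fix) ∧
    (∀ c ∈ fix, ∃ x : DTs, conjS x = c ∨ conjS x = act c) ∧
      (∀ x y : DTs, (conjS x = conjS y ∨ conjS x = act (conjS y)) → x = y)

end Structure

/-! ## §4, pp. 30–36: Theorem 4.7, Lemma 4.8, Propositions 4.9–4.10 -/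

section Families

variable {G : Type*}

/-- **Theorem 4.7 (characterization of the families of stable orbital integrals).**  «Suppose that for each Haar measure
`dg` on `G`, Cartan subgroup `T` and Haar measure `dt` on `T` we are given a function `γ ↦ Φ^T(γ, dt, dg)` on `T_reg`.
Then there is a Schwartz function `f` on `G` such that `Φ^T(γ, dt, dg) = Φ¹_f(γ, dt, dg)` for all `T`, `γ`, `dt` and `dg`
if and only if: (I) `Φ^T(γ, αdt, βdg) = (β/α) Φ^T(γ, dt, dg)` for `α, β > 0`; (II) `Φ^T(γ, dt, dg) = Φ^{T^ω}(γ^ω, (dt)^ω,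
dg)` for `ω ∈ 𝔄(T)`; (III) if `Ψ^T(γ, dt, dg) = R_T(γ)Φ^T(γ, dt, dg)` then `Ψ^T` extends to a Schwartz function on
`T^I_reg` and (a) [= `Shelstad1979_4_7_IIIa_continuity` at every semiregular `γ₀` with `ξ_α(γ₀) = 1` where every `ωα`,
`ω ∈ Ω(M,T)`, is compact], (b) [= `Shelstad1979_4_7_IIIb_jump` at every semiregular `γ₀` with `ξ_α(γ₀) = 1`, `α`
noncompact, `I⁺` adapted to `α`].  In (III) and (IIIa) the choice of `I⁺` is arbitrary.»  Typed on the space `Fam` of ALL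
families `{Φ^T(·, dt, dg)}` (module doc), with `famOf f = {Φ¹_f(·, dt, dg)}`, `S` the Schwartz space of `G`, and the five
conditions as predicates on `Fam`: `condI` ((I) for every `T, γ`; one `T` at a time it is `Shelstad1979_4_7_I_homogeneity`),
`condII` ((II); `Shelstad1979_4_7_II_stableInvariance`), `condIII` («`Ψ^T` extends to a Schwartz function on `T^I_reg`» for
every `T` — the Schwartz space of `T^I_reg` [6] is not in the tree), `condIIIa`, `condIIIb`.
[cite: Shelstad1979, Thm. 4.7 (pp. 30–31)] -/
def Shelstad1979_4_7_characterization {Fam : Type*} (S : Set (G → ℂ)) (famOf : (G → ℂ) → Fam)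
    (condI condII condIII condIIIa condIIIb : Fam → Prop) (Φ : Fam) : Prop :=
  (∃ f ∈ S, famOf f = Φ) ↔ (condI Φ ∧ condII Φ ∧ condIII Φ ∧ condIIIa Φ ∧ condIIIb Φ)

variable {C : Type*} [Preorder C] {V : C → Type*} [∀ c, Zero (V c)]

/-- **Lemma 4.8.**  «Fix a Cartan subgroup `T₀` and suppose that for each `T` conjugate to `T₀` and for each Haar measure
`dt` on `T` and `dg` on `G` we are given a function `Φ^T( , dt, dg)` on `T_reg` satisfying (I), (II) and (III′) `Ψ^T( , dt,
dg)` extends to a Schwartz function on `T`.  Then there exists a Schwartz function `f` on `G` such that (a) `Φ^T(γ, dt, dg)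
= Φ¹_f(γ, dt, dg)`, `γ ∈ T_reg`, for all such `T`, `dt` and `dg`, and (b) `Φ¹_f( , dt′, dg) ≡ 0` unless `⟨T′⟩ ≤ ⟨T⟩` for any
`dt′` on `T′` and `dg`.»  Data (module doc, «families»): `C = 𝔱(G)` with its order `≤` (p. 13); `V c` the families on the
class `c` (with `0`); `famOf f c = {Φ¹_f(·, dt, dg)}_{T ∈ c}`; `S`; `condI condII condIII' : (c : C) → V c → Prop`; `c₀ =
⟨T₀⟩`.  (b) is typed as «`famOf f c = 0` whenever `¬ c ≤ c₀`» (`⟨T′⟩ ≰ ⟨T₀⟩`).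
[cite: Shelstad1979, Lemma 4.8 (pp. 32–33)] -/
def Shelstad1979_4_8_existence (S : Set (G → ℂ)) (famOf : (G → ℂ) → (c : C) → V c)
    (condI condII condIII' : (c : C) → V c → Prop) (c₀ : C) : Prop :=
  ∀ Φ₀ : V c₀, condI c₀ Φ₀ → condII c₀ Φ₀ → condIII' c₀ Φ₀ →
    ∃ f ∈ S, famOf f c₀ = Φ₀ ∧ ∀ c : C, ¬ c ≤ c₀ → famOf f c = 0

/-- `ν_{(X,Y,m)}(f) = sup_{g ∈ G} (1 + σ(g))^m |(XfY)(g)| / Ξ(g)`, `f ∈ 𝒞(G)`, for `X, Y` in the universal enveloping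
algebra of `𝔤` and `m > 0` («`σ`, `Ξ` are defined as usual (cf. [6])») — the Schwartz seminorms of `G`.  Data: `σ Ξ : G → ℝ`;
`XY : (G → ℂ) → (G → ℂ)` — `f ↦ XfY`; `m`.  Print's display has no bars around `(XfY)(g)` and `m > 0`; the absolute value
`‖·‖` is the reading of [6] (the seminorms of the Schwartz space), and `m = 0` is allowed here (harmless).  A real supremum
(`⨆`, junk `0` if unbounded; finite on `𝒞(G)` by definition of the Schwartz space). [cite: Shelstad1979, §4 (p. 35)] -/
noncomputable def hcSeminorm (σ Ξ : G → ℝ) (XY : (G → ℂ) → (G → ℂ)) (m : ℕ) (f : G → ℂ) : ℝ :=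
  ⨆ g : G, (1 + σ g) ^ m * ‖XY f g‖ / Ξ g

/-- **Proposition 4.9 (the wave packets `f(Λ)`).**  In the setting of pp. 33–35 (`T = °T·A` as in [6], `𝔛` the
characters of `°T`, `𝔞*` the real dual of `log A`, `C` the closed [p. 35: `log Λ ∈ C`] chamber, `Ψ^∨(Λ, ν)` the Fourier
transform of `Ψ = Ψ^T( , dt, dg)`, `N_Λ = N(ν ↦ Ψ^∨(Λ, ν))`, `|Λ|` the length of `log Λ`, `y(Λ, ν)` the function of p. 35):
«Fix `X, Y, m`.  Then there is a polynomial `℘`, a continuous seminorm `N` on `𝒞(𝔞*)` and for each `Λ` with `log Λ ∈ C`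
a function `f(Λ) ∈ 𝒞(G)` such that (1) `Ψ^T_{f(Λ)}( , dt, dg) = ∫_{𝔞*} Ψ^∨(Λ, ν) y(Λ, ν) dν`; (2) `Φ¹_{f(Λ)}( , dt′, dg) ≡ 0`
for any `T′` with `⟨T′⟩ ≰ ⟨T⟩`; and (3) `ν_{(X,Y,m)}(f(Λ)) ≤ N_Λ ℘(|Λ|)`.»  Data: the «families» data `C, V, famOf, S` with
`c₀ = ⟨T⟩`; `Λs : Set X𝔛` — the `Λ` with `log Λ ∈ C`; `packetValue Λ : V c₀` — the right side of (1) as a family on `⟨T⟩`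
(through `Ψ = R_T Φ`); `Sa : Type*` with `semis : Set (Sa → ℝ)` — `𝒞(𝔞*)` and its continuous seminorms; `ΨhatOf Λ : Sa` —
`ν ↦ Ψ^∨(Λ, ν)`; `len Λ = |Λ|`; `nu` — `ν_{(X,Y,m)}` (e.g. `hcSeminorm σ Ξ XY m`).  (2) is typed as «`famOf f c = 0`
whenever `¬ c ≤ c₀`», the same condition as Lemma 4.8 (b) (which print derives from it, p. 36).
[cite: Shelstad1979, Prop. 4.9 (p. 35)] -/
def Shelstad1979_4_9_wavePackets {X𝔛 Sa : Type*} (S : Set (G → ℂ)) (famOf : (G → ℂ) → (c : C) → V c) (c₀ : C)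
    (Λs : Set X𝔛) (packetValue : X𝔛 → V c₀) (semis : Set (Sa → ℝ)) (ΨhatOf : X𝔛 → Sa) (len : X𝔛 → ℝ)
    (nu : (G → ℂ) → ℝ) : Prop :=
  ∃ (℘ : Polynomial ℝ) (N : Sa → ℝ), N ∈ semis ∧
    ∀ Λ ∈ Λs, ∃ f ∈ S, famOf f c₀ = packetValue Λ ∧ (∀ c : C, ¬ c ≤ c₀ → famOf f c = 0) ∧
      nu f ≤ N (ΨhatOf Λ) * ℘.eval (len Λ)

/-- **Proposition 4.10.**  With `π` the restriction to `°M` of the square-integrable representation of `M` attached to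
`Λe^{iν}` (`π` depends only on `Λ`) and `K` the maximal compact subgroup (p. 36): «There is a polynomial `℘` with the
following property: for each `Λ` there exists an irreducible unitary representation `σ(Λ)` of `K` contained in
`Ind(π | K ∩ M, K ∩ M, K)` and such that `‖σ(Λ)‖ ≤ ℘(|Λ|)`.  Here `‖ ‖` denotes the length of the highest weight.»  Data:
`X𝔛` — the `Λ`; `Khat` — the irreducible unitary representations of `K`; `occurs Λ σ` — «`σ` is contained in
`Ind(π_Λ | K ∩ M, K ∩ M, K)`»; `hwLen σ = ‖σ‖`; `len Λ = |Λ|`. [cite: Shelstad1979, Prop. 4.10 (p. 36)] -/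
def Shelstad1979_4_10_KTypeBound {X𝔛 Khat : Type*} (occurs : X𝔛 → Khat → Prop) (hwLen : Khat → ℝ)
    (len : X𝔛 → ℝ) : Prop :=
  ∃ ℘ : Polynomial ℝ, ∀ Λ : X𝔛, ∃ σ : Khat, occurs Λ σ ∧ hwLen σ ≤ ℘.eval (len Λ)

end Families

end Literature.NumberTheory.Automorphic.Shelstad1979.StableOrbitalIntegrals
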